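import Mathlib
import Summits.ValiantsHypothesis.ValiantsHypothesis.Theorems.RigidityForcesSymmetryRankRigidMinimalReprLaplaceFiveSectorSplitDefs
import Summits.ValiantsHypothesis.ValiantsHypothesis.Theorems.RigidityForcesSymmetryRankRigidMinimalReprLaplaceFiveTriangleNoSideSym

/-!
# ValiantsHypothesis / RigidityForcesSymmetry — crux `LaplaceOptimalFive` (stmt-ValiantsHypothesis-24813), crux idea
`young-shadow` (K1) on the 4-CYCLE support `C₄ = {01, 12, 23, 03}`: **SUM-RIGIDITY CERTIFICATES, classes `2111` and `221`**

PORT (near-verbatim, `shadow`/`C4Support` unfolded) of `stub_ident2111`, `stub_ident221` and `total_split` of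
`Cruxes/LaplaceOptimalFive/SumRigidC4Sketch.lean` — written and kernel-checked by val-idea-19 g7 (pen note
`NOTE-g7-24813-star-closed-rays.md` §12 / §12.L, certificates `g7/sumcert-identities.txt`, refereed by val-idea-crit-3 g5); this prover
seat only files them under `Theorems/`.  SUM-RIGIDITY: on `C₄` the four Young shadows of a side-symmetric pair decomposition of `P₅`,
read with a common 2-set of letters on the short side and a common 3-multiset on the long side, SUM to the value of `Cat₂,₃(x₀⋯x₄)`;
here the two degenerate letter classes (one shared letter: value `0`; two shared letters: value `0`), each an explicit
`ℤ`-combination of instances of the decomposition identity after side-symmetry rewrites.  Class `11111` (value `1`) is the sequel file,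
the endgame is ✓ `LaplaceFiveSumRigidC4.endgame`.

Honest framing.  K1 on `C₄` follows by composition (sequel); K1 on the star / `K₃ ⊔ K₂` / `≥ 5` splits, S2′, `LaplaceOptimalFive`
(OPEN · CONTESTED 72/120), `RankRigidMinimalRepr`, `VP ≠ VNP` are NOT proved.  No definitions, no `sorry`; Mathlib + tree only.
-/

set_option linter.dupNamespace false

namespace Summit.ValiantsHypothesis.ValiantsHypothesis.Theorems.RigidityForcesSymmetryRankRigidMinimalRepr

namespace LaplaceFiveSumRigidC4

open Finset LaplaceFiveSectorSplit

variable {N : ℕ}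

/-- On a `C₄` support the total is the sum of the four shadows. -/
theorem total_split (T : Finset (Fin N)) (S : Fin N → Finset (Fin 5)) (u w : Fin N → (Fin 5 → Fin 5) → ℂ)
    (hC : ∀ t ∈ T, S t = {0, 1} ∨ S t = {1, 2} ∨ S t = {2, 3} ∨ S t = {0, 3}) (v : Fin 5 → Fin 5) :
    ∑ t ∈ T, u t v * w t v = (∑ t ∈ T.filter (fun t => S t = {0, 1}), u t v * w t v) + ((∑ t ∈ T.filter (fun t => S t = {1, 2}), u t v * w t v)
      + ((∑ t ∈ T.filter (fun t => S t = {2, 3}), u t v * w t v) + (∑ t ∈ T.filter (fun t => S t = {0, 3}), u t v * w t v))) := by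
  classical
  have hmaps : ∀ t ∈ T, S t ∈ ({{0, 1}, {1, 2}, {2, 3}, {0, 3}} : Finset (Finset (Fin 5))) := by
    intro t ht
    rcases hC t ht with h | h | h | h <;> simp [h]
  rw [← Finset.sum_fiberwise_of_maps_to hmaps, Finset.sum_insert (by decide), Finset.sum_insert (by decide),
    Finset.sum_insert (by decide), Finset.sum_singleton]

/-- Identity of letter class `2111` — PROVED (certificate `D(abadc) + D(acabd) − D(acadb)`, 7 side-symmetry rewrites): value `0` when the two sides
share one letter (placement: the shared letter at slots 0 and 2). -/
theorem ident2111 (T : Finset (Fin N)) (S : Fin N → Finset (Fin 5)) (u w : Fin N → (Fin 5 → Fin 5) → ℂ)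
    (hdec : IsSplitDecomposition T S u w) (hsym : SideSymmetric T S u w) (hC : ∀ t ∈ T, S t = {0, 1} ∨ S t = {1, 2} ∨ S t = {2, 3} ∨ S t = {0, 3})
    (a b c d : Fin 5) (_hinj : Function.Injective ![a, b, c, d]) :
    (∑ t ∈ T.filter (fun t => S t = {0, 1}), u t ![a, b, a, c, d] * w t ![a, b, a, c, d]) + (∑ t ∈ T.filter (fun t => S t = {1, 2}), u t ![a, a, b, c, d] * w t ![a, a, b, c, d])
      + (∑ t ∈ T.filter (fun t => S t = {2, 3}), u t ![a, c, a, b, d] * w t ![a, c, a, b, d]) + (∑ t ∈ T.filter (fun t => S t = {0, 3}), u t ![a, a, c, b, d] * w t ![a, a, c, b, d]) = 0 := by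
  classical
  obtain ⟨hu, hw, hid⟩ := hdec
  -- certificate `D(abadc) + D(acabd) − D(acadb)`: the decomposition identity at three non-injective words
  have hninj : ∀ x y z : Fin 5, ¬ Function.Injective (![a, x, a, y, z] : Fin 5 → Fin 5) := by
    intro x y z h
    have h02 : (0 : Fin 5) = 2 := h (show (![a, x, a, y, z] : Fin 5 → Fin 5) 0 = ![a, x, a, y, z] 2 from rfl)
    exact absurd h02 (by decide)
  have h1 := hid ![a, b, a, d, c]
  have h2 := hid ![a, c, a, b, d]
  have h3 := hid ![a, c, a, d, b]
  rw [if_neg (hninj _ _ _), total_split T S u w hC] at h1 h2 h3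
  -- word relations (slot permutations inside one side of the relevant split)
  have r1 : (![a, c, a, d, b] : Fin 5 → Fin 5) = ![a, b, a, d, c] ∘ ⇑(Equiv.swap (1 : Fin 5) 4) := by
    funext i; fin_cases i <;> simp [Equiv.swap_apply_of_ne_of_ne]
  have r2 : (![a, c, a, d, b] : Fin 5 → Fin 5) = ![a, c, a, b, d] ∘ ⇑(Equiv.swap (3 : Fin 5) 4) := by
    funext i; fin_cases i <;> simp [Equiv.swap_apply_of_ne_of_ne]
  have r3 : (![a, b, a, d, c] : Fin 5 → Fin 5) = ![a, b, a, c, d] ∘ ⇑(Equiv.swap (3 : Fin 5) 4) := by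
    funext i; fin_cases i <;> simp [Equiv.swap_apply_of_ne_of_ne]
  have r4 : (![a, b, a, d, c] : Fin 5 → Fin 5)
      = (![a, a, b, c, d] ∘ ⇑(Equiv.swap (3 : Fin 5) 4)) ∘ ⇑(Equiv.swap (1 : Fin 5) 2) := by
    funext i; fin_cases i <;> simp [Equiv.swap_apply_of_ne_of_ne]
  have r5 : (![a, c, a, b, d] : Fin 5 → Fin 5) = ![a, a, c, b, d] ∘ ⇑(Equiv.swap (1 : Fin 5) 2) := by
    funext i; fin_cases i <;> simp [Equiv.swap_apply_of_ne_of_ne]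
  have eA : (∑ t ∈ T.filter (fun t => S t = {2, 3}), u t ![a, c, a, d, b] * w t ![a, c, a, d, b]) = (∑ t ∈ T.filter (fun t => S t = {2, 3}), u t ![a, b, a, d, c] * w t ![a, b, a, d, c]) := by
    rw [r1]
    exact LaplaceFiveTriangleSeparation.shadow_inv_right T S u w hu hsym {2, 3} (Equiv.swap 1 4) (by decide) _
  have eB : (∑ t ∈ T.filter (fun t => S t = {0, 3}), u t ![a, c, a, d, b] * w t ![a, c, a, d, b]) = (∑ t ∈ T.filter (fun t => S t = {0, 3}), u t ![a, b, a, d, c] * w t ![a, b, a, d, c]) := by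
    rw [r1]
    exact LaplaceFiveTriangleSeparation.shadow_inv_right T S u w hu hsym {0, 3} (Equiv.swap 1 4) (by decide) _
  have eC : (∑ t ∈ T.filter (fun t => S t = {0, 1}), u t ![a, c, a, d, b] * w t ![a, c, a, d, b]) = (∑ t ∈ T.filter (fun t => S t = {0, 1}), u t ![a, c, a, b, d] * w t ![a, c, a, b, d]) := by
    rw [r2]
    exact LaplaceFiveTriangleSeparation.shadow_inv_right T S u w hu hsym {0, 1} (Equiv.swap 3 4) (by decide) _
  have eD : (∑ t ∈ T.filter (fun t => S t = {1, 2}), u t ![a, c, a, d, b] * w t ![a, c, a, d, b]) = (∑ t ∈ T.filter (fun t => S t = {1, 2}), u t ![a, c, a, b, d] * w t ![a, c, a, b, d]) := by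
    rw [r2]
    exact LaplaceFiveTriangleSeparation.shadow_inv_right T S u w hu hsym {1, 2} (Equiv.swap 3 4) (by decide) _
  have eE : (∑ t ∈ T.filter (fun t => S t = {0, 1}), u t ![a, b, a, d, c] * w t ![a, b, a, d, c]) = (∑ t ∈ T.filter (fun t => S t = {0, 1}), u t ![a, b, a, c, d] * w t ![a, b, a, c, d]) := by
    rw [r3]
    exact LaplaceFiveTriangleSeparation.shadow_inv_right T S u w hu hsym {0, 1} (Equiv.swap 3 4) (by decide) _
  have eF : (∑ t ∈ T.filter (fun t => S t = {1, 2}), u t ![a, b, a, d, c] * w t ![a, b, a, d, c]) = (∑ t ∈ T.filter (fun t => S t = {1, 2}), u t ![a, a, b, c, d] * w t ![a, a, b, c, d]) := by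
    rw [r4]
    rw [LaplaceFiveTriangleSeparation.shadow_inv_left T S u w hw hsym {1, 2} (Equiv.swap 1 2) (by decide)
      (![a, a, b, c, d] ∘ ⇑(Equiv.swap (3 : Fin 5) 4))]
    exact LaplaceFiveTriangleSeparation.shadow_inv_right T S u w hu hsym {1, 2} (Equiv.swap 3 4) (by decide) _
  have eH : (∑ t ∈ T.filter (fun t => S t = {0, 3}), u t ![a, c, a, b, d] * w t ![a, c, a, b, d]) = (∑ t ∈ T.filter (fun t => S t = {0, 3}), u t ![a, a, c, b, d] * w t ![a, a, c, b, d]) := by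
    rw [r5]
    exact LaplaceFiveTriangleSeparation.shadow_inv_right T S u w hu hsym {0, 3} (Equiv.swap 1 2) (by decide) _
  linear_combination h1 + h2 - h3 + eA + eB + eC + eD - eE - eF - eH

/-- Identity of letter class `221` — PROVED (certificate: the single word `ababc`, on which every split of the 4-cycle reads `(ab | abc)`; 2 rewrites):
value `0` when the two sides share two letters. -/
theorem ident221 (T : Finset (Fin N)) (S : Fin N → Finset (Fin 5)) (u w : Fin N → (Fin 5 → Fin 5) → ℂ)
    (hdec : IsSplitDecomposition T S u w) (hsym : SideSymmetric T S u w) (hC : ∀ t ∈ T, S t = {0, 1} ∨ S t = {1, 2} ∨ S t = {2, 3} ∨ S t = {0, 3})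
    (a b c : Fin 5) (_hinj : Function.Injective ![a, b, c]) :
    (∑ t ∈ T.filter (fun t => S t = {0, 1}), u t ![a, b, a, b, c] * w t ![a, b, a, b, c]) + (∑ t ∈ T.filter (fun t => S t = {1, 2}), u t ![a, a, b, b, c] * w t ![a, a, b, b, c])
      + (∑ t ∈ T.filter (fun t => S t = {2, 3}), u t ![a, b, a, b, c] * w t ![a, b, a, b, c]) + (∑ t ∈ T.filter (fun t => S t = {0, 3}), u t ![a, a, b, b, c] * w t ![a, a, b, b, c]) = 0 := by
  classical
  obtain ⟨hu, hw, hid⟩ := hdec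
  -- the decomposition identity at the ONE word `ababc` (not injective: slots 0 and 2 both read `a`)
  have h0 := hid ![a, b, a, b, c]
  have hninj : ¬ Function.Injective (![a, b, a, b, c] : Fin 5 → Fin 5) := by
    intro h
    have h02 : (0 : Fin 5) = 2 := h (show (![a, b, a, b, c] : Fin 5 → Fin 5) 0 = ![a, b, a, b, c] 2 from rfl)
    exact absurd h02 (by decide)
  rw [if_neg hninj] at h0
  -- split the total into the four shadows of the 4-cycle
  have hmaps : ∀ t ∈ T, S t ∈ ({{0, 1}, {1, 2}, {2, 3}, {0, 3}} : Finset (Finset (Fin 5))) := by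
    intro t ht
    rcases hC t ht with h | h | h | h <;> simp [h]
  rw [← Finset.sum_fiberwise_of_maps_to hmaps, Finset.sum_insert (by decide), Finset.sum_insert (by decide),
    Finset.sum_insert (by decide), Finset.sum_singleton] at h0
  -- on `ababc` every split of the 4-cycle reads `(ab | abc)`: move the two shadows stated at `aabbc` there by side-symmetry
  have hword : (![a, b, a, b, c] : Fin 5 → Fin 5) = ![a, a, b, b, c] ∘ ⇑(Equiv.swap (1 : Fin 5) 2) := by
    funext i
    fin_cases i <;> simp [Equiv.swap_apply_of_ne_of_ne]
  have h12 : (∑ t ∈ T.filter (fun t => S t = {1, 2}), u t ![a, b, a, b, c] * w t ![a, b, a, b, c]) = (∑ t ∈ T.filter (fun t => S t = {1, 2}), u t ![a, a, b, b, c] * w t ![a, a, b, b, c]) := by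
    rw [hword]
    exact LaplaceFiveTriangleSeparation.shadow_inv_left T S u w hw hsym {1, 2} (Equiv.swap 1 2) (by decide) _
  have h03 : (∑ t ∈ T.filter (fun t => S t = {0, 3}), u t ![a, b, a, b, c] * w t ![a, b, a, b, c]) = (∑ t ∈ T.filter (fun t => S t = {0, 3}), u t ![a, a, b, b, c] * w t ![a, a, b, b, c]) := by
    rw [hword]
    exact LaplaceFiveTriangleSeparation.shadow_inv_right T S u w hu hsym {0, 3} (Equiv.swap 1 2) (by decide) _
  rw [← h12, ← h03]
  linear_combination h0

end LaplaceFiveSumRigidC4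

end Summit.ValiantsHypothesis.ValiantsHypothesis.Theorems.RigidityForcesSymmetryRankRigidMinimalRepr
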